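import Summits.ResolutionOfSingularities.ResolutionOfSingularities.Theorems.HomologicalConductorNoZenoNoetherianCapture
import Summits.ResolutionOfSingularities.ResolutionOfSingularities.Theorems.HomologicalConductorNoZenoCaptureStep
import Literature.RingTheory.CohomologyAnnihilator.RegularLocalRing
import HarnessLib

/-!
# Crux `NoZenoR` / `NoZeno` (stmt-ResolutionOfSingularities-19943 / -16483), β1ʳ¹♯ layer:
# PRINCIPALIZATION ON ONE RUNG of the generic-fibre ladder ⟺ termination (tri-2 TRIAGE v15 §A(1) «(CAP-j)» made a theorem)

`[OURS · L W4.4]` Cell res-hironaka, crux chain W4.4 (seat res-L0-w44-stub-1 g9; sequel to the port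
`…NoZenoNoetherianCapture` of ideator res-L0-w44-idea-1's card 12 `generic-fibre-ladder`).  Nothing here is a
statement of the manuscript under review (Hironaka 2017); AI-written, weaker than expert review; support-level,
counted 0.

res-L0-w44-tri-2's reading of card 12 (TRIAGE v15 §A R25 (1)): «capture monotonicity is formal ⇒ the residual
CONTRACTS to (CAP-j) ∃ j m₀: T_{m₀} ≤ R_j ∧ ∀ m ≥ m₀, ca(T_m)·R_j PRINCIPAL on ONE rung».  This file proves exactly
that contraction, for the ladder `R_0 → R_1 → ⋯` (quadratic sequence along `O` of a two-dimensional regular local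
ring `R_0 ∋ k` of `K` dominated by `O`) of `NoetherianCapture.stage_captured_by_rung`, with «`ca(T_m)·R_j` principal»
in the generator-from-the-conductor form «ONE element of `ca(T_m)` divides every element of `ca(T_m)` inside `R_j`»
(for the local ring `R_j ⊇ T_m` this is principality of the extended ideal, the generator chosen in `ca(T_m)` by
Nakayama; only this form is used):

* `isPrincipal_span_ca_of_divides` — the divisibility form gives `Ideal.span (ca T ∩ S)` principal in any
  `k`-subalgebra `S ⊇ T`.
* `tower_succ_le_rung_of_divides` — CAPTURE STEP ON A RUNG: `T_m ≤ R_j` and one conductor element dividing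
  `ca(T_m)` inside `R_j` ⇒ `T_{m+1} ≤ R_j` (the tree's `SandwichCluster.captureOfPrincipal_of_isRegularLocalRing`
  with `V := O`; rungs are regular — `isRegularLocalRing_sequence` — with fraction field `K` and dominated by `O`).
* `rung_captures_of_eventuallyDivides` — hence eventual principalization on `R_j` from a captured stage on keeps
  ALL later stages in `R_j`.
* **`terminates_iff_eventuallyPrincipalOnRung`** — under `StrictDrop`: some stage is regular ⟺ (CAP-j).  (⇐) by the
  above and `terminates_iff_boundedCaptureIndex` (NOETHERIAN CAPTURE); (⇒) the regular stage `T_M` is captured by a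
  rung and `1 ∈ ca(T_m) = T_m = T_M` for `m ≥ M`.  `conductor_not_principalized_io` is the complement (no regular
  stage ⇒ on every rung holding a stage, infinitely many later conductors are not principalized).

So on branch (b) of β1ʳ¹♯ the complement of NoZeno reads: along `O`'s arc through the generic-fibre ladder, on EVERY
rung `R_j` containing a stage, infinitely many later conductors `ca(T_m)` extend to NON-principal ideals of `R_j`
(«conductor base points for ever», tri-2 §A(2)).  Remark (tri-2 §A(2)'s typed exercise): the tree's divisorial
toolkit `ZariskiDescent.Zariski.stalls_or_catches` does not instantiate on this ladder with `V := O` — it needs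
`IsNoetherianRing ↥V`, while here `O` is its own non-noetherian dominator — and its «catches» disjunct holds on the
ladder for free (`AbhyankarQuadraticUnion_holds`: every element of `O` lies in some rung); the ladder's content is
(CAP-j) alone.

References: S. Abhyankar (1956), Lemma 12 / Prop. 8 (union lemma, regularity of quadratic transforms; via the tree)
[`Abhyankar1956Valuations`]; J. Lipman, Publ. IHÉS 36 (1969) §18 and M. Spivakovsky, *Sandwiched singularities …*
(1990) §II for the capture step (via the tree's `captureOfPrincipal`) [`Lipman1969`, `Spivakovsky1990`].
-/

noncomputable section

-- single-problem summit: the doubled namespace component `ResolutionOfSingularities` is forced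
set_option linter.dupNamespace false

namespace Summit.ResolutionOfSingularities.ResolutionOfSingularities.Theorems.NoZeno.NoetherianCapture

open Summit.ResolutionOfSingularities.ResolutionOfSingularities.Theses.HomologicalConductor
open Summit.ResolutionOfSingularities.ResolutionOfSingularities.Theorems.NoZeno.Birth
open Summit.ResolutionOfSingularities.ResolutionOfSingularities.Theorems
open Summit.ResolutionOfSingularities.ResolutionOfSingularities.Theorems.NoZeno
open Literature.AlgebraicGeometry.Resolution
open Literature.RingTheory.CohomologyAnnihilator (cohomologyAnnihilator_eq_top_of_isRegularLocalRing)
open IsLocalRing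

variable {k K : Type} [Field k] [Field K] [Algebra k K]

/-! ## The divisibility form of «`ca(T)·S` is principal» -/

/-- If one element `g ∈ ca T` divides every element of `ca T` inside the `k`-subalgebra `S ⊇ T`, then the ideal of
`S` spanned by `ca T` is principal (generated by `g`). [folklore] -/
theorem isPrincipal_span_ca_of_divides (T S : Subalgebra k K) (hTS : T ≤ S) {g : K} (hg : g ∈ ca T)
    (hdiv : ∀ c ∈ ca T, ∃ y ∈ S, c = g * y) :
    (Ideal.span {s : ↥S | (s : K) ∈ ca T}).IsPrincipal := by
  have hgS : g ∈ S := hTS (ca_subset T hg)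
  refine ⟨⟨⟨g, hgS⟩, le_antisymm ?_ ?_⟩⟩
  · refine Ideal.span_le.mpr fun s hs => ?_
    obtain ⟨y, hyS, hsy⟩ := hdiv (s : K) hs
    refine SetLike.mem_coe.mpr (Ideal.mem_span_singleton'.mpr ⟨⟨y, hyS⟩, ?_⟩)
    apply Subtype.ext
    simp only [Subalgebra.coe_mul, hsy, mul_comm]
  · change Ideal.span {(⟨g, hgS⟩ : ↥S)} ≤ _
    exact Ideal.span_mono (Set.singleton_subset_iff.mpr hg)

/-- In a REGULAR stage the divisibility form holds trivially (`1 ∈ ca T = T`), inside any `S ⊇ T`. [folklore] -/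
theorem divides_ca_of_isRegularLocalRing (T S : Subalgebra k K) (hTS : T ≤ S) (hreg : IsRegularLocalRing ↥T) :
    ∃ g ∈ ca T, ∀ c ∈ ca T, ∃ y ∈ S, c = g * y := by
  haveI := hreg
  have h1 : (1 : K) ∈ ca T := by
    have htop := cohomologyAnnihilator_eq_top_of_isRegularLocalRing ↥T
    have h1' : ((1 : ↥T) : K) ∈ ca T := (tn_coe_mem_ca_iff T 1).mpr (by rw [htop]; trivial)
    simpa using h1'
  exact ⟨1, h1, fun c hc => ⟨c, hTS (ca_subset T hc), (one_mul c).symm⟩⟩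

/-! ## The capture step on a rung of the ladder -/

/-- **CAPTURE STEP ON A RUNG.**  Along the quadratic sequence `R_•` along `O` of a two-dimensional regular local ring
`R_0 ∋ k` of `K` dominated by `O`: if the stage `T_m` lies in the rung `R_j` and ONE element of `ca(T_m)` divides
every element of `ca(T_m)` inside `R_j` (principalization of the conductor on the rung), then `T_{m+1} ≤ R_j`.
Proof: `R_j` is a regular local ring (`isRegularLocalRing_sequence`) with fraction field `K`, dominated by `O`, and
`T_{m+1} ⊆ O`; apply the tree's `SandwichCluster.captureOfPrincipal_of_isRegularLocalRing` with `V := O`.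
[OURS; cite: Lipman1969, §18 (capture by principalization, via the tree)] -/
theorem tower_succ_le_rung_of_divides (O : ValuationSubring K) (A : Subalgebra k K)
    (hk : ∀ c : k, algebraMap k K c ∈ O) (hAO : A.toSubring ≤ O.toSubring) (R : ℕ → Subring K)
    (hreg : IsRegularLocalRing ↥(R 0)) (hof : IsLocalRingOf (R 0)) (hdomR : SubringDominates (R 0) O.toSubring)
    (hstep : ∀ i, IsQuadraticTransformAlong O (R i) (R (i + 1))) (hkR : ∀ c : k, algebraMap k K c ∈ R 0)
    (j m : ℕ) (hTR : ∀ x ∈ tower O A m, x ∈ R j)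
    (hdiv : ∃ g ∈ ca (tower O A m), ∀ c ∈ ca (tower O A m), ∃ y ∈ R j, c = g * y) :
    ∀ x ∈ tower O A (m + 1), x ∈ R j := by
  have hmono : Monotone R := sequence_monotone hstep
  let Rj : Subalgebra k K := { R j with algebraMap_mem' := fun c => hmono (Nat.zero_le j) (hkR c) }
  have hmemRj : ∀ x : K, x ∈ Rj ↔ x ∈ R j := fun x => Iff.rfl
  have hTS : tower O A m ≤ Rj := fun x hx => (hmemRj x).mpr (hTR x hx)
  haveI : IsFractionRing ↥Rj K := isFractionRing_of_isLocalRingOf_le hof.2 (hmono (Nat.zero_le j))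
  have hS : IsRegularLocalRing ↥Rj := isRegularLocalRing_sequence hreg hstep j
  obtain ⟨g, hg, hdvd⟩ := hdiv
  have hca : (Ideal.span {s : ↥Rj | (s : K) ∈ ca (tower O A m)}).IsPrincipal :=
    isPrincipal_span_ca_of_divides (tower O A m) Rj hTS hg
      (fun c hc => by obtain ⟨y, hy, hcy⟩ := hdvd c hc; exact ⟨y, (hmemRj y).mpr hy, hcy⟩)
  have hdomj : SubringDominates (R j) O.toSubring := (sequence_dominates hdomR hstep j).1
  have hVS : ∀ t : K, t ∈ Rj → t ∈ (O : Set K) ∧ (t⁻¹ ∈ (O : Set K) → t⁻¹ ∈ Rj) := fun t ht =>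
    ⟨hdomj.1 ((hmemRj t).mp ht), fun hinv => (hmemRj _).mpr (hdomj.2 t ((hmemRj t).mp ht) hinv)⟩
  have hVT : ∀ t : K, t ∈ loc O (nrm (chart O (tower O A m))) → t ∈ (O : Set K) := fun t ht =>
    TraceSocle.stage_le O A hk hAO (m + 1) t (by rw [tower_succ]; exact ht)
  have hle : loc O (nrm (chart O (tower O A m))) ≤ Rj :=
    SandwichCluster.captureOfPrincipal_of_isRegularLocalRing O O (tower O A m) Rj hTS hS hca hVS hVT
  intro x hx
  rw [tower_succ] at hx
  exact (hmemRj x).mp (hle hx)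

/-- **Eventual principalization on one rung keeps all later stages in that rung.**  If `T_{m₀} ≤ R_j` and for every
`m ≥ m₀` one element of `ca(T_m)` divides `ca(T_m)` inside `R_j`, then `T_m ≤ R_j` for all `m ≥ m₀`. [OURS] -/
theorem rung_captures_of_eventuallyDivides (O : ValuationSubring K) (A : Subalgebra k K)
    (hk : ∀ c : k, algebraMap k K c ∈ O) (hAO : A.toSubring ≤ O.toSubring) (R : ℕ → Subring K)
    (hreg : IsRegularLocalRing ↥(R 0)) (hof : IsLocalRingOf (R 0)) (hdomR : SubringDominates (R 0) O.toSubring)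
    (hstep : ∀ i, IsQuadraticTransformAlong O (R i) (R (i + 1))) (hkR : ∀ c : k, algebraMap k K c ∈ R 0)
    (j m₀ : ℕ) (hTR : ∀ x ∈ tower O A m₀, x ∈ R j)
    (hdiv : ∀ m : ℕ, m₀ ≤ m → ∃ g ∈ ca (tower O A m), ∀ c ∈ ca (tower O A m), ∃ y ∈ R j, c = g * y) :
    ∀ m : ℕ, m₀ ≤ m → ∀ x ∈ tower O A m, x ∈ R j := by
  intro m hm
  induction m, hm using Nat.le_induction with
  | base => exact hTR
  | succ n hmn ih =>
    exact tower_succ_le_rung_of_divides O A hk hAO R hreg hof hdomR hstep hkR j n ih (hdiv n hmn)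

/-! ## (CAP-j) ⟺ termination -/

/-- **NoZeno ⟺ EVENTUAL PRINCIPALIZATION ON ONE RUNG (under StrictDrop; res-L0-w44-tri-2's (CAP-j)).**  For the
canonical normalised `ca`-tower of `(O, A)` and a ladder `R_•` (quadratic sequence along `O` of a two-dimensional
regular local ring `R_0 ∋ k` of `K` dominated by `O`): some stage is a regular local ring iff there are a rung `R_j`
and an index `m₀` with `T_{m₀} ≤ R_j` such that for every `m ≥ m₀` ONE element of `ca(T_m)` divides every element
of `ca(T_m)` inside `R_j`.  (⇒) capture of the regular stage `T_M` by a rung (`stage_captured_by_rung`) and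
`1 ∈ ca(T_m)`, `T_m = T_M` for `m ≥ M`; (⇐) `rung_captures_of_eventuallyDivides` + NOETHERIAN CAPTURE
(`terminates_iff_boundedCaptureIndex`). [OURS] -/
theorem terminates_iff_eventuallyPrincipalOnRung (hD : StrictDrop) (p : ℕ) (hp : p.Prime) (k K : Type)
    [Field k] [CharP k p] [Field K] [Algebra k K] (O : ValuationSubring K) (A : Subalgebra k K)
    (hk : ∀ c : k, algebraMap k K c ∈ O) (hA : A.FG) (hfr : IsFractionRing ↥A K)
    (hAO : A.toSubring ≤ O.toSubring) (R : ℕ → Subring K) (hreg : IsRegularLocalRing ↥(R 0))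
    (hdim : ringKrullDim ↥(R 0) = 2) (hof : IsLocalRingOf (R 0)) (hdomR : SubringDominates (R 0) O.toSubring)
    (hstep : ∀ i, IsQuadraticTransformAlong O (R i) (R (i + 1))) (hkR : ∀ c : k, algebraMap k K c ∈ R 0) :
    (∃ m : ℕ, IsRegularLocalRing ↥(tower O A m)) ↔
      ∃ j m₀ : ℕ, (∀ x ∈ tower O A m₀, x ∈ R j) ∧
        ∀ m : ℕ, m₀ ≤ m → ∃ g ∈ ca (tower O A m), ∀ c ∈ ca (tower O A m), ∃ y ∈ R j, c = g * y := by
  have hmono : Monotone R := sequence_monotone hstep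
  constructor
  · rintro ⟨M, hM⟩
    obtain ⟨j, hj⟩ := stage_captured_by_rung p hp k K O A hk hA hfr hAO R hreg hdim hof hdomR hstep hkR M
    let Rj : Subalgebra k K := { R j with algebraMap_mem' := fun c => hmono (Nat.zero_le j) (hkR c) }
    refine ⟨j, M, hj, fun m hm => ?_⟩
    have heq : tower O A m = tower O A M := tower_eq_of_le_of_isRegularLocalRing O A hk hfr hAO M hM m hm
    have hregm : IsRegularLocalRing ↥(tower O A m) := by rw [heq]; exact hM
    have hTS : tower O A m ≤ Rj := fun x hx => hj x (by rwa [heq] at hx)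
    exact divides_ca_of_isRegularLocalRing (tower O A m) Rj hTS hregm
  · rintro ⟨j, m₀, hTR, hdiv⟩
    exact (terminates_iff_boundedCaptureIndex hD p hp k K O A hk hA hfr hAO R hreg hdim hof hdomR hstep hkR).mpr
      ⟨j, m₀, rung_captures_of_eventuallyDivides O A hk hAO R hreg hof hdomR hstep hkR j m₀ hTR hdiv⟩

/-- **CONDUCTOR BASE POINTS FOR EVER (the complement, res-L0-w44-tri-2 TRIAGE v15 §A(2)).**  Under `StrictDrop`, if NO
stage is regular, then on every rung `R_j` holding a stage `T_{m₀}` there are arbitrarily late stages `T_m` (`m ≥ m₀`)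
whose conductor is NOT principalized on `R_j`: no element of `ca(T_m)` divides all of `ca(T_m)` inside `R_j`. [OURS] -/
theorem conductor_not_principalized_io (hD : StrictDrop) (p : ℕ) (hp : p.Prime) (k K : Type)
    [Field k] [CharP k p] [Field K] [Algebra k K] (O : ValuationSubring K) (A : Subalgebra k K)
    (hk : ∀ c : k, algebraMap k K c ∈ O) (hA : A.FG) (hfr : IsFractionRing ↥A K)
    (hAO : A.toSubring ≤ O.toSubring) (R : ℕ → Subring K) (hreg : IsRegularLocalRing ↥(R 0))
    (hdim : ringKrullDim ↥(R 0) = 2) (hof : IsLocalRingOf (R 0)) (hdomR : SubringDominates (R 0) O.toSubring)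
    (hstep : ∀ i, IsQuadraticTransformAlong O (R i) (R (i + 1))) (hkR : ∀ c : k, algebraMap k K c ∈ R 0)
    (hnone : ∀ m : ℕ, ¬ IsRegularLocalRing ↥(tower O A m)) (j m₀ : ℕ) (hTR : ∀ x ∈ tower O A m₀, x ∈ R j) :
    ∃ m : ℕ, m₀ ≤ m ∧ ∀ g ∈ ca (tower O A m), ∃ c ∈ ca (tower O A m), ∀ y ∈ R j, c ≠ g * y := by
  by_contra h
  push Not at h
  obtain ⟨m, hm⟩ :=
    (terminates_iff_eventuallyPrincipalOnRung hD p hp k K O A hk hA hfr hAO R hreg hdim hof hdomR hstep hkR).mpr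
      ⟨j, m₀, hTR, h⟩
  exact hnone m hm

end Summit.ResolutionOfSingularities.ResolutionOfSingularities.Theorems.NoZeno.NoetherianCapture

end
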